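import Summits.BirchSwinnertonDyer.BirchSwinnertonDyer.Theorems.Rank2Observatory2DescCertificates
import Summits.BirchSwinnertonDyer.BirchSwinnertonDyer.Theorems.Rank2Observatory2DescNormPrime
import HarnessLib

/-!
# BirchSwinnertonDyer — rank ≥ 2 observatory: linear-form generators `c₀ + c₁θ + c₂θ²` in a cubic order

HONEST FRAMING: per-curve certified theorems and census instruments; no claim on BSD in rank ≥ 2.

Generic addendum of the KERNEL-2DESC instrument (design `b2b-bsdr2-cert-3/KERNEL-2DESC.md` §4
A3/A5, production stage S4). Every element the per-curve certificates name — the root `θ` of `F`,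
the prime generators `Gⱼ` of the support of `F′(θ)`, the unit cofactor and its inverse — is a
`ℤ`-combination `lin hα c₀ c₁ c₂ = c₀ + c₁α + c₂α²` of the power basis of the monogenic cubic
field `K = ℚ(α)`. This file proves ONCE the five facts a per-curve file needs about such an
element, each from a numeric side condition the kernel checks:
* `norm_lin_eq` — `N(lin) = n` from the norm form (`MonicCubic.norm_lin`);
* `lin_prime_of_prime` / `lin_prime_of_pow` — primality from `|N| = p` resp. `|N| = p^k`
  (`k = 2, 3`) plus the residual non-vanishing certificate (`ringHom_lin_ne_zero`);
* `lin_ne` — elements with different coordinates differ (power-basis independence);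
* `lin_pos` / `lin_neg` — the sign at a real place from an isolating interval of `ρ(α)`.
So per-curve files carry no generator definitions and no per-field "primes" addenda.

Sorry-free; axioms `propext`, `Classical.choice`, `Quot.sound`. [folklore]
[cite: Marcus2018, Ch. 3, Thm. 22] (prime ideals and norms)
-/

-- single-conjunct summit: `Summit.BirchSwinnertonDyer.BirchSwinnertonDyer.…` repeats the name by design
set_option linter.dupNamespace false

noncomputable section

open scoped Classical NumberField

open Literature.NumberTheory.NumberFields Polynomial Module NumberField

namespace Summit.BirchSwinnertonDyer.BirchSwinnertonDyer.Rank2Observatory.TwoDescCubic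

variable {K : Type*} [Field K] [NumberField K] {a b c : ℤ} {θ : K}

/-- The algebraic integer `c₀ + c₁θ + c₂θ²` of `K = ℚ(θ)`, `θ` a root of the monic cubic
`X³ + aX² + bX + c`. [folklore] -/
def lin (hθ : aeval θ (MonicCubic.poly a b c) = 0) (c₀ c₁ c₂ : ℤ) : 𝓞 K :=
  (c₀ : 𝓞 K) + (c₁ : 𝓞 K) * MonicCubic.thetaInt hθ + (c₂ : 𝓞 K) * MonicCubic.thetaInt hθ ^ 2

omit [NumberField K] in
/-- `lin` in `K`. [folklore] -/
theorem lin_coe (hθ : aeval θ (MonicCubic.poly a b c) = 0) (c₀ c₁ c₂ : ℤ) :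
    ((lin hθ c₀ c₁ c₂ : 𝓞 K) : K) = (c₀ : K) + (c₁ : K) * θ + (c₂ : K) * θ ^ 2 := by
  simp only [lin, map_add, map_mul, map_pow, map_intCast, MonicCubic.coe_thetaInt]

omit [NumberField K] in
/-- `algebraMap` form of `lin_coe`. [folklore] -/
theorem algebraMap_lin (hθ : aeval θ (MonicCubic.poly a b c) = 0) (c₀ c₁ c₂ : ℤ) :
    algebraMap (𝓞 K) K (lin hθ c₀ c₁ c₂) = (c₀ : K) + (c₁ : K) * θ + (c₂ : K) * θ ^ 2 :=
  lin_coe hθ c₀ c₁ c₂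

/-- **Norm**: `N(c₀ + c₁θ + c₂θ²) = n`, read off the norm form. [folklore] -/
theorem norm_lin_eq (hirr : Irreducible (MonicCubic.polyQ a b c))
    (hθ : aeval θ (MonicCubic.poly a b c) = 0) (h3 : finrank ℚ K = 3) (c₀ c₁ c₂ : ℤ) {n : ℤ}
    (hn : MonicCubic.normForm a b c c₀ c₁ c₂ = n) :
    Algebra.norm ℚ ((lin hθ c₀ c₁ c₂ : 𝓞 K) : K) = ((n : ℤ) : ℚ) := by
  rw [lin_coe, ← hn]
  have h := MonicCubic.norm_lin hirr hθ h3 c₀ c₁ c₂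
  simpa only [Rat.cast_intCast] using h

/-- `|N_{K/ℚ}(lin)| = |n|` down in `ℤ`. [folklore] -/
theorem natAbs_norm_lin (hirr : Irreducible (MonicCubic.polyQ a b c))
    (hθ : aeval θ (MonicCubic.poly a b c) = 0) (h3 : finrank ℚ K = 3) (c₀ c₁ c₂ : ℤ) {n : ℤ}
    (hn : MonicCubic.normForm a b c c₀ c₁ c₂ = n) :
    (Algebra.norm ℤ (lin hθ c₀ c₁ c₂)).natAbs = n.natAbs :=
  natAbs_norm_eq_of_norm_eq (norm_lin_eq hirr hθ h3 c₀ c₁ c₂ hn)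

/-- **Prime of degree one**: `|N| = p` prime. [cite: Marcus2018, Ch. 3, Thm. 22] -/
theorem lin_prime_of_prime (hirr : Irreducible (MonicCubic.polyQ a b c))
    (hθ : aeval θ (MonicCubic.poly a b c) = 0) (h3 : finrank ℚ K = 3) (c₀ c₁ c₂ : ℤ) {n : ℤ}
    (hn : MonicCubic.normForm a b c c₀ c₁ c₂ = n) (hp : n.natAbs.Prime) :
    Prime (lin hθ c₀ c₁ c₂) := by
  apply prime_of_natAbs_norm_prime
  rw [natAbs_norm_lin hirr hθ h3 c₀ c₁ c₂ hn]
  exact hp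

/-- **Prime of degree `k = 2, 3`**: `|N| = p^k` and `c₀ + c₁t + c₂t² ≠ 0` at every root `t` of
the cubic mod `p` (so no conjugate of the rational prime `p` divides it).
[cite: Marcus2018, Ch. 3, Thm. 22] -/
theorem lin_prime_of_pow (hirr : Irreducible (MonicCubic.polyQ a b c))
    (hθ : aeval θ (MonicCubic.poly a b c) = 0) (h3 : finrank ℚ K = 3) (c₀ c₁ c₂ : ℤ) {n : ℤ}
    (hn : MonicCubic.normForm a b c c₀ c₁ c₂ = n) {p k : ℕ} (hp : p.Prime) (hk : k = 2 ∨ k = 3)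
    (hN : n.natAbs = p ^ k)
    (hcert : ∀ t : ZMod p, t ^ 3 + (a : ZMod p) * t ^ 2 + (b : ZMod p) * t + (c : ZMod p) = 0 →
      (c₀ : ZMod p) + (c₁ : ZMod p) * t + (c₂ : ZMod p) * t ^ 2 ≠ 0) :
    Prime (lin hθ c₀ c₁ c₂) := by
  refine prime_of_natAbs_norm_eq_prime_pow hp hk ?_ ?_
  · rw [natAbs_norm_lin hirr hθ h3 c₀ c₁ c₂ hn, hN]
  · intro ψ
    exact ringHom_lin_ne_zero hθ ψ c₀ c₁ c₂ hcert

/-- **Distinct coordinates give distinct elements** (`1, θ, θ²` are `ℚ`-independent). [folklore] -/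
theorem lin_ne (hirr : Irreducible (MonicCubic.polyQ a b c))
    (hθ : aeval θ (MonicCubic.poly a b c) = 0) (h3 : finrank ℚ K = 3) {c₀ c₁ c₂ d₀ d₁ d₂ : ℤ}
    (hne : c₀ ≠ d₀ ∨ c₁ ≠ d₁ ∨ c₂ ≠ d₂) : lin hθ c₀ c₁ c₂ ≠ lin hθ d₀ d₁ d₂ := by
  intro h
  have hK := congrArg (fun x : 𝓞 K => (x : K)) h
  simp only [lin_coe] at hK
  have hlin := powIndep_algebraMap hirr hθ h3 ((c₀ - d₀ : ℤ) : ℚ) ((c₁ - d₁ : ℤ) : ℚ)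
    ((c₂ - d₂ : ℤ) : ℚ) (by
      simp only [map_sub, map_intCast, Int.cast_sub]
      linear_combination hK)
  simp only [Int.cast_eq_zero, sub_eq_zero] at hlin
  rcases hne with h0 | h1 | h2
  · exact h0 hlin.1
  · exact h1 hlin.2.1
  · exact h2 hlin.2.2

omit [NumberField K] in
/-- **A unit from an explicit inverse.** [folklore] -/
theorem isUnit_lin (hθ : aeval θ (MonicCubic.poly a b c) = 0) (c₀ c₁ c₂ d₀ d₁ d₂ : ℤ)
    (h : lin hθ c₀ c₁ c₂ * lin hθ d₀ d₁ d₂ = 1) : IsUnit (lin hθ c₀ c₁ c₂) :=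
  IsUnit.of_mul_eq_one _ h

/-- **Positive at the real place `ρ`** from an isolating interval `lo < ρ(θ) < hi` (`0 ≤ lo`).
[folklore] -/
theorem lin_pos (hθ : aeval θ (MonicCubic.poly a b c) = 0) (ρ : K →+* ℝ) {lo hi : ℚ}
    (h0 : 0 ≤ lo) (hlo : ((lo : ℚ) : ℝ) < ρ θ) (hhi : ρ θ < ((hi : ℚ) : ℝ)) (c₀ c₁ c₂ : ℤ)
    (hc : 0 < (c₀ : ℚ) + min (c₁ * lo) (c₁ * hi) + min (c₂ * lo ^ 2) (c₂ * hi ^ 2)) :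
    0 < ρ ((lin hθ c₀ c₁ c₂ : 𝓞 K) : K) := by
  have h := quad_pos_of_interval h0 hlo hhi c₀ c₁ c₂ hc
  rw [lin_coe]
  simpa only [map_add, map_mul, map_pow, map_intCast] using h

/-- **Negative at the real place `ρ`** from an isolating interval. [folklore] -/
theorem lin_neg (hθ : aeval θ (MonicCubic.poly a b c) = 0) (ρ : K →+* ℝ) {lo hi : ℚ}
    (h0 : 0 ≤ lo) (hlo : ((lo : ℚ) : ℝ) < ρ θ) (hhi : ρ θ < ((hi : ℚ) : ℝ)) (c₀ c₁ c₂ : ℤ)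
    (hc : (c₀ : ℚ) + max (c₁ * lo) (c₁ * hi) + max (c₂ * lo ^ 2) (c₂ * hi ^ 2) < 0) :
    ρ ((lin hθ c₀ c₁ c₂ : 𝓞 K) : K) < 0 := by
  have h := quad_neg_of_interval h0 hlo hhi c₀ c₁ c₂ hc
  rw [lin_coe]
  simpa only [map_add, map_mul, map_pow, map_intCast] using h

/-- Sign bit `false` (= non-negative) from `lin_pos`, in the `Bool ↔` form of `admStd_sound`.
[folklore] -/
theorem sg_false_iff_of_pos {x : ℝ} (hx : 0 < x) : (false = true ↔ x < 0) := by
  simp [not_lt.mpr hx.le]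

/-- Sign bit `true` (= negative), in the `Bool ↔` form of `admStd_sound`. [folklore] -/
theorem sg_true_iff_of_neg {x : ℝ} (hx : x < 0) : (true = true ↔ x < 0) := by
  simp [hx]

end Summit.BirchSwinnertonDyer.BirchSwinnertonDyer.Rank2Observatory.TwoDescCubic

end
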